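import Literature.Analysis.FluidPDE.ClassicalSolution
import Literature.Analysis.FluidPDE.LerayHopf
import HarnessLib

/-!
# The finite-horizon Freidlin–Wentzell quasipotential of Navier–Stokes (control form)

Analysis/FluidPDE definition file (sorry-free, no named facts).

For a dynamical system `ẋ = b(x)` perturbed by a small white noise with identity covariance, the
Freidlin–Wentzell **action functional** of a path `φ` on `[0, T]` is
`S_{0T}(φ) = ½ ∫₀ᵀ |φ̇ₛ − b(φₛ)|² ds` (Freidlin 1985, §1.7, Thm. 7.4 with `(aⁱʲ)` the unit matrix) and
the **quasi-potential** of a state `x` relative to the equilibrium `0` is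
`V(x) = inf { S_{0T}(φ) : φ₀ = 0, φ_T = x, T > 0 }`, `V(0) = 0` (Freidlin 1985, §4.1). For the
stochastic Navier–Stokes equations `u' + νAu + B(u,u) = f` the same objects read
`S_T(u) = ½ ∫₀ᵀ |u' + νAu + B(u,u)|²_H dt` — the `L²` cost of the **forcing** that drives the path —
and `U(φ) = inf { S_T(u) : u(0) = 0, u(T) = φ, T > 0 }` (Brzeźniak–Cerrai–Freidlin 2015, §1 and
§6; on the `2`-D torus `U(φ) = |φ|²_V`, Thm. 7.1; the covariance-weighted functional
`S^δ_T(u) = ½ ∫ |Q_δ⁻¹(u' + νAu + B(u,u))|²_H` is their (5.x)/§1). No probability is needed to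
*state* these objects: they are deterministic optimal-control functionals.

This file vendors them for **classical** forced Navier–Stokes paths on a finite-dimensional
inner-product space `E` (Clay: `E = ℝ³`), over the tree's predicates
`IsClassicalNSSolutionOn` (forced classical solutions, one-sided time derivative on `Icc 0 T₀`),
`HasUniformRapidDecayOn` (uniformly Schwartz paths), `eEnergy` (`∫⁻ ‖·‖ₑ²`) and `IsLerayHopfOn`,
with a **finite horizon** `τ` (paths of duration `T₀ ≤ τ`; the scale-free `T₀ < ∞` version is the
limit `τ → ∞`, `nsQuasipotential_anti`):

* `nsAction T₀ g = ∫⁻_{s ∈ [0,T₀]} ∫⁻ ‖g s x‖ₑ² ∈ [0, ∞]` — the forcing action (twice BCF's `S_T`;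
  we do **not** carry the factor `½`);
* `IsNSControlPathOn ν T₀ w q g` — an admissible controlled path from rest: `0 < T₀`, `(w, q)` a
  classical solution on `E × [0, T₀]` with viscosity `ν` and forcing `g`, `w` uniformly Schwartz,
  `w 0 = 0`;
* `nsQuasipotential ν τ x = ⨅ { nsAction T₀ g : IsNSControlPathOn ν T₀ w q g, T₀ ≤ τ, w T₀ = x }`
  — the finite-horizon quasipotential `V_{ν,τ}(x)` (identity covariance); `⊤` if `x` is not
  reachable (in particular for `τ ≤ 0`, `nsQuasipotential_eq_top_of_nonpos`);
* `IsNSFreeEvolution ν y T₁ x` and `nsQuasipotentialWithTail ν τ x` — the **two-piece** variant: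
  a controlled path from rest to `w T₀`, then an initial segment `[0, T₁]` of an *unforced*
  classical Leray–Hopf solution from `w T₀` ending at `x`, total duration `T₀ + T₁ ≤ τ`, cost =
  the action of the forced piece only. This is the concatenation behind the monotonicity of the
  quasi-potential along unperturbed trajectories ("a free tail costs nothing"), made part of the
  definition so that the Lyapunov inequality is definitional
  (`nsQuasipotentialWithTail_le_nsQuasipotential_of_flow`) and no smoothness at the junction is
  needed;
* `nsQuasipotentialCov R ν τ x` — the covariance-weighted version: forcing `g s = R (h s)` with
  cost `nsAction T₀ h`, for an operator `R` on spatial fields (`R = Q^{1/2}` for a covariance `Q`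
  in the Da Prato–Zabczyk convention, `R = Q_δ` in BCF's); `nsQuasipotentialCov id = nsQuasipotential`.

## API (all proved)

`nsQuasipotential_le` / `le_nsQuasipotential_iff` / `nsQuasipotential_lt_iff` (the `⨅`
interface), `nsQuasipotential_anti` (antitone in the horizon), `nsQuasipotential_eq_top_of_nonpos`,
`nsQuasipotential_zero` (`V_{ν,τ}(0) = 0` for `τ > 0`, by the resting path), the same for the
two-piece variant (`…WithTail…`, the rest state needing the zero Leray–Hopf tail
`isLerayHopfOn_zero`), the bridge to the *literal* reachable-set predicate
(`nsQuasipotentialWithTail_le_of_reach`, `reach_of_nsQuasipotentialWithTail_lt`) and the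
equivalence of the two ways of writing a coercivity statement — over the reachable set at action
level `a`, or over the sublevel set `{V ≤ a}` (`nsQuasipotentialWithTail_sublevel_iff_reach`).

## Not here (targets of the consuming route, not known results in this generality)

the energy lower bound `‖x‖₂² ≤ τ · V_{ν,τ}(x)`, the `2`-D bound `ν‖∇x‖₂² ≤ ½ V` (BCF Thm. 7.1 is
the torus *identity* for the functional-analytic `S_T`), the parabolic `1`-homogeneity
`V_{ν,τ/λ²}(λ x(λ·)) = λ V_{ν,τ}(x)` (needs the dilation covariance of `HasUniformRapidDecayOn`,
absent from the tree) and the `3`-D completed square.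

## Mathlib / tree search

Mathlib (this pin) has no action functional / quasipotential / minimum-energy control notion
(searched `quasipotential`, `actionFunctional`, `minimumAction`); the tree has none either. Used:
`iInf` over `ℝ≥0∞`, `MeasureTheory.lintegral`, and the accepted FluidPDE predicates above.

## References

* M. I. Freidlin, *Functional Integration and Partial Differential Equations*, Annals of Math.
  Studies 109 (1985), §1.7 Thm. 7.4 (action functional), §4.1 (quasi-potential). [Freidlin1985]
* M. I. Freidlin, A. D. Wentzell, *Random Perturbations of Dynamical Systems*, 3rd ed. (2012),
  Ch. 4 (quasipotential near an equilibrium; Thm. IV.3.1, the finite-dimensional `V = 2U`).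
  [FreidlinWentzell2012]
* Z. Brzeźniak, S. Cerrai, M. Freidlin, *Quasipotential and exit time for 2D stochastic
  Navier–Stokes equations driven by space time white noise*, PTRF 162 (2015) = arXiv:1401.6299,
  §1, §6 (def. of `U`, `U_δ`, Prop. 6.1), Thm. 7.1. [BrzezniakCerraiFreidlin2015]
-/

noncomputable section

open MeasureTheory Set Function Filter
open _root_.Topology
open scoped InnerProductSpace ENNReal NNReal Laplacian

namespace Literature.Analysis.FluidPDE

/-! ### Trivial (resting) solutions: the zero field -/

section Zero

variable {X : Type*} [NormedAddCommGroup X] [NormedSpace ℝ X]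
variable {F : Type*} [NormedAddCommGroup F] [NormedSpace ℝ F]

/-- The zero field decays uniformly rapidly on every time set (all its space–time derivatives
vanish). [folklore] -/
theorem hasUniformRapidDecayOn_zero (S : Set ℝ) : HasUniformRapidDecayOn S (0 : ℝ → X → F) := by
  intro n K
  refine ⟨0, fun t _ x => ?_⟩
  have h0 : uncurry (0 : ℝ → X → F) = 0 := rfl
  rw [h0, iteratedFDerivWithin_zero]
  simp

variable {E : Type*} [NormedAddCommGroup E] [InnerProductSpace ℝ E] [FiniteDimensional ℝ E]

/-- **The rest state is a classical solution**: `u ≡ 0`, `p ≡ 0` solve the unforced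
Navier–Stokes system classically on every time set and for every viscosity (every term of the
momentum equation vanishes). [folklore] -/
theorem isClassicalNSSolutionOn_zero (S : Set ℝ) (ν : ℝ) :
    IsClassicalNSSolutionOn S ν (0 : ℝ → E → E) 0 0 where
  smooth_velocity := by
    have h0 : uncurry (0 : ℝ → E → E) = fun _ => 0 := rfl
    unfold IsSmoothSpaceTimeOn
    rw [h0]
    exact contDiffOn_const
  smooth_pressure := by
    have h0 : uncurry (0 : ℝ → E → ℝ) = fun _ => 0 := rfl
    unfold IsSmoothSpaceTimeOn
    rw [h0]
    exact contDiffOn_const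
  momentum t _ x := by
    have h1 : timeDerivWithin S (0 : ℝ → E → E) t x = 0 := by
      simp [timeDerivWithin]
    have h2 : convect ((0 : ℝ → E → E) t) ((0 : ℝ → E → E) t) x = 0 := by
      simp [convect]
    have h3 : (Δ ((0 : ℝ → E → E) t)) x = 0 := by
      simp [Pi.zero_def]
    have h4 : gradient ((0 : ℝ → E → ℝ) t) x = 0 := by
      simp [Pi.zero_def]
    rw [h1, h2, h3, h4]
    simp
  divFree t _ x := by
    simp [VectorCalculus.divergence]

end Zero

/-! ### Controlled paths from rest and the forcing action -/

section Control

variable {E : Type*} [NormedAddCommGroup E] [InnerProductSpace ℝ E] [FiniteDimensional ℝ E]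

/-- **Admissible controlled path from rest** on `[0, T₀]`, `T₀ > 0`: a classical solution
`(w, q)` of the Navier–Stokes system with viscosity `ν` *forced by* `g` on `E × [0, T₀]`
(`IsClassicalNSSolutionOn (Icc 0 T₀) ν g w q`: `∂ₜw + (w·∇)w = νΔw − ∇q + g`, `div w = 0`), with
`w` uniformly Schwartz on `[0, T₀]` and starting at rest, `w 0 = 0`. These are the competitors
`u ∈ C([0,T]; H)`, `u(0) = 0`, of the quasi-potential `U` of Brzeźniak–Cerrai–Freidlin (2015),
§6, in the classical (smooth, rapidly decaying) class used by the Clay statements; the forcing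
`g` plays the role of `u' + νAu + B(u,u)`. [cite: BrzezniakCerraiFreidlin2015, §6 (definition of U)] -/
structure IsNSControlPathOn (ν T₀ : ℝ) (w : ℝ → E → E) (q : ℝ → E → ℝ) (g : ℝ → E → E) :
    Prop where
  /-- The duration is positive. -/
  pos : 0 < T₀
  /-- `(w, q)` is a classical solution forced by `g` on `E × [0, T₀]`. -/
  isClassical : IsClassicalNSSolutionOn (Icc 0 T₀) ν g w q
  /-- `w` is uniformly Schwartz on `[0, T₀]`. -/
  decay : HasUniformRapidDecayOn (Icc 0 T₀) w
  /-- The path starts at rest. -/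
  initial : w 0 = 0

/-- Unfolding `IsNSControlPathOn` into its four conjuncts (the shape inlined in route
statements). [folklore] -/
theorem isNSControlPathOn_iff {ν T₀ : ℝ} {w : ℝ → E → E} {q : ℝ → E → ℝ} {g : ℝ → E → E} :
    IsNSControlPathOn ν T₀ w q g ↔ 0 < T₀ ∧ IsClassicalNSSolutionOn (Icc 0 T₀) ν g w q ∧
      HasUniformRapidDecayOn (Icc 0 T₀) w ∧ w 0 = 0 :=
  ⟨fun h => ⟨h.pos, h.isClassical, h.decay, h.initial⟩, fun h => ⟨h.1, h.2.1, h.2.2.1, h.2.2.2⟩⟩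

/-- **The resting path is admissible**: `w ≡ 0`, `q ≡ 0`, `g ≡ 0` on `[0, T₀]`, `T₀ > 0`
(it reaches the rest state `0` at zero cost: `V(0) = 0`, Freidlin 1985, §4.1). [cite: Freidlin1985, §4.1] -/
theorem isNSControlPathOn_zero (ν : ℝ) {T₀ : ℝ} (hT₀ : 0 < T₀) :
    IsNSControlPathOn ν T₀ (0 : ℝ → E → E) 0 0 :=
  ⟨hT₀, isClassicalNSSolutionOn_zero _ ν, hasUniformRapidDecayOn_zero _, rfl⟩

variable [MeasurableSpace E] [BorelSpace E]

/-- **The forcing action** `A_{T₀}(g) = ∫₀^{T₀} ∫ |g(s, x)|² dx ds ∈ [0, ∞]` of a forcing `g` on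
`[0, T₀]` (extended integrals, no junk value): twice the Freidlin–Wentzell / Brzeźniak–Cerrai–
Freidlin action `S_T(u) = ½ ∫₀ᵀ |u' + νAu + B(u,u)|²_H dt` of the path it drives (BCF 2015, §1;
Freidlin 1985, §1.7, Thm. 7.4: `S_{0T}(φ) = ½ ∫ |φ̇ − b(φ)|²` for identity diffusion). We do not
carry the factor `½`. [cite: BrzezniakCerraiFreidlin2015, §1 (action functional S_T)] -/
def nsAction (T₀ : ℝ) (g : ℝ → E → E) : ℝ≥0∞ :=
  ∫⁻ s in Icc 0 T₀, eEnergy (g s)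

/-- Unfolding the forcing action. [cite: BrzezniakCerraiFreidlin2015, §1 (action functional S_T)] -/
theorem nsAction_def (T₀ : ℝ) (g : ℝ → E → E) :
    nsAction T₀ g = ∫⁻ s in Icc 0 T₀, eEnergy (g s) :=
  rfl

/-- The zero forcing has zero action. [folklore] -/
@[simp]
theorem nsAction_zero (T₀ : ℝ) : nsAction T₀ (0 : ℝ → E → E) = 0 := by
  simp [nsAction, eEnergy]

end Control

/-! ### The finite-horizon quasipotential (identity covariance) -/

section Quasipotential

variable {E : Type*} [NormedAddCommGroup E] [InnerProductSpace ℝ E] [FiniteDimensional ℝ E]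
  [MeasurableSpace E] [BorelSpace E]

/-- **The finite-horizon Freidlin–Wentzell quasipotential of Navier–Stokes with identity
covariance, in control form**: `V_{ν,τ}(x) = inf { A_{T₀}(g) }` over all admissible controlled
paths `(T₀, w, q, g)` from rest (`IsNSControlPathOn ν T₀ w q g`) of duration `T₀ ≤ τ` ending at
`x`, `w T₀ = x` — the `L²`-cheapest forcing driving a classical, uniformly Schwartz
Navier–Stokes path from rest to `x` within time `τ`; `⊤` if `x` is not so reachable. This is
`U(φ) = inf { S_T(u) : T > 0, u(0) = 0, u(T) = φ }` of Brzeźniak–Cerrai–Freidlin (2015), §6 (twice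
it, and with the horizon capped at `τ`; their Thm. 7.1 computes `U(φ) = |φ|²_V` on the `2`-D
torus), the Navier–Stokes instance of the quasi-potential `V(x) = inf { S_{0T}(φ) : φ₀ = 0,
φ_T = x }` of Freidlin (1985), §4.1 / Freidlin–Wentzell, Ch. 4. [cite: BrzezniakCerraiFreidlin2015, §6 (definition of U)] -/
def nsQuasipotential (ν τ : ℝ) (x : E → E) : ℝ≥0∞ :=
  ⨅ (T₀ : ℝ) (w : ℝ → E → E) (q : ℝ → E → ℝ) (g : ℝ → E → E)
    (_ : IsNSControlPathOn ν T₀ w q g ∧ T₀ ≤ τ ∧ w T₀ = x), nsAction T₀ g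

variable {ν τ τ' : ℝ} {x : E → E}

/-- Every admissible path of duration `≤ τ` reaching `x` bounds the quasipotential by its action
(`iInf_le`). [cite: BrzezniakCerraiFreidlin2015, §6 (definition of U)] -/
theorem nsQuasipotential_le {T₀ : ℝ} {w : ℝ → E → E} {q : ℝ → E → ℝ} {g : ℝ → E → E}
    (h : IsNSControlPathOn ν T₀ w q g) (hT : T₀ ≤ τ) (hx : w T₀ = x) :
    nsQuasipotential ν τ x ≤ nsAction T₀ g :=
  iInf_le_of_le T₀ <| iInf_le_of_le w <| iInf_le_of_le q <| iInf_le_of_le g <| iInf_le _ ⟨h, hT, hx⟩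

/-- Lower bounds for the quasipotential are exactly the uniform lower bounds for the action of
admissible paths (`le_iInf_iff`). [cite: BrzezniakCerraiFreidlin2015, §6 (definition of U)] -/
theorem le_nsQuasipotential_iff {a : ℝ≥0∞} :
    a ≤ nsQuasipotential ν τ x ↔ ∀ (T₀ : ℝ) (w : ℝ → E → E) (q : ℝ → E → ℝ) (g : ℝ → E → E),
      IsNSControlPathOn ν T₀ w q g → T₀ ≤ τ → w T₀ = x → a ≤ nsAction T₀ g := by
  simp only [nsQuasipotential, le_iInf_iff, and_imp]

/-- Strict upper bounds: `V_{ν,τ}(x) < a` iff some admissible path of duration `≤ τ` reaches `x`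
with action `< a` (`iInf_lt_iff`). [cite: BrzezniakCerraiFreidlin2015, §6 (definition of U)] -/
theorem nsQuasipotential_lt_iff {a : ℝ≥0∞} :
    nsQuasipotential ν τ x < a ↔ ∃ (T₀ : ℝ) (w : ℝ → E → E) (q : ℝ → E → ℝ) (g : ℝ → E → E),
      IsNSControlPathOn ν T₀ w q g ∧ T₀ ≤ τ ∧ w T₀ = x ∧ nsAction T₀ g < a := by
  simp only [nsQuasipotential, iInf_lt_iff, exists_prop, and_assoc]

/-- **The quasipotential is antitone in the horizon**: a longer horizon admits more paths,
`V_{ν,τ'} ≤ V_{ν,τ}` for `τ ≤ τ'` (in the limit `τ → ∞` one recovers the uncapped `U` of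
Brzeźniak–Cerrai–Freidlin 2015, §6). [cite: BrzezniakCerraiFreidlin2015, §6 (definition of U)] -/
theorem nsQuasipotential_anti (h : τ ≤ τ') : nsQuasipotential ν τ' x ≤ nsQuasipotential ν τ x :=
  le_nsQuasipotential_iff.2 fun _ _ _ _ hp hT hx => nsQuasipotential_le hp (hT.trans h) hx

/-- With a non-positive horizon nothing is reachable (paths have positive duration):
`V_{ν,τ} ≡ ⊤` for `τ ≤ 0`. [folklore] -/
theorem nsQuasipotential_eq_top_of_nonpos (hτ : τ ≤ 0) : nsQuasipotential ν τ x = ⊤ :=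
  eq_top_iff.2 <| le_nsQuasipotential_iff.2 fun _ _ _ _ hp hT _ =>
    absurd (hp.pos.trans_le (hT.trans hτ)) (lt_irrefl 0)

/-- **The rest state has zero quasipotential**: `V_{ν,τ}(0) = 0` for every `τ > 0` (the resting
path `w = q = g = 0` on `[0, τ]` is admissible and costs nothing; Freidlin 1985, §4.1:
`V(0) = 0`). [cite: Freidlin1985, §4.1] -/
theorem nsQuasipotential_zero (ν : ℝ) (hτ : 0 < τ) : nsQuasipotential ν τ (0 : E → E) = 0 := by
  refine le_antisymm ?_ bot_le
  simpa using nsQuasipotential_le (isNSControlPathOn_zero (E := E) ν hτ) le_rfl rfl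

end Quasipotential

/-! ### The two-piece variant: a free classical Leray–Hopf tail -/

section Tail

variable {E : Type*} [NormedAddCommGroup E] [InnerProductSpace ℝ E] [FiniteDimensional ℝ E]
  [MeasurableSpace E] [BorelSpace E]

/-- **Free (unforced) evolution** `y ↝ x` in time `T₁`: there is an unforced classical solution
`(v, pv)` on `E × [0, T₂)`, `T₁ < T₂`, which is a Leray–Hopf weak solution with datum `y`
(finite energy, energy inequality — this excludes the parasitic pressure-driven classical
solutions), starts at `v 0 = y` and passes through `x` at time `T₁`, `v T₁ = x`. Following the
unperturbed flow costs no action: this is the tail that makes the quasi-potential non-increasing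
along unperturbed trajectories (Freidlin 1985, §4.1; Freidlin–Wentzell, Ch. 4). [folklore] -/
def IsNSFreeEvolution (ν : ℝ) (y : E → E) (T₁ : ℝ) (x : E → E) : Prop :=
  ∃ (T₂ : ℝ) (v : ℝ → E → E) (pv : ℝ → E → ℝ), T₁ < T₂ ∧
    IsClassicalNSSolutionOn (Ico 0 T₂) ν 0 v pv ∧ IsLerayHopfOn T₂ ν 0 y v ∧ v 0 = y ∧ v T₁ = x

/-- **The two-piece finite-horizon quasipotential** `Ṽ_{ν,τ}(x) = inf A_{T₀}(g)` over admissible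
controlled paths `(T₀, w, q, g)` from rest followed by a free classical Leray–Hopf evolution
`w T₀ ↝ x` of length `T₁ ≥ 0`, with total duration `T₀ + T₁ ≤ τ`; only the forced piece is
charged. The reachable set `{Ṽ_{ν,τ} ≤ a}` is the one quantified over in the coercivity
statements of route QuasipotentialCoercivity (`nsQuasipotentialWithTail_sublevel_iff_reach`),
and the Lyapunov inequality along the free flow is definitional
(`nsQuasipotentialWithTail_le_nsQuasipotential_of_flow`). Minimum-energy reachability with free
coasting is the standard optimal-control relaxation; as a published object the closest is the
quasi-potential with uncapped horizon (Freidlin 1985, §4.1; BCF 2015, §6), for which the free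
tail is implicit. [folklore] -/
def nsQuasipotentialWithTail (ν τ : ℝ) (x : E → E) : ℝ≥0∞ :=
  ⨅ (T₀ : ℝ) (T₁ : ℝ) (w : ℝ → E → E) (q : ℝ → E → ℝ) (g : ℝ → E → E)
    (_ : IsNSControlPathOn ν T₀ w q g ∧ 0 ≤ T₁ ∧ T₀ + T₁ ≤ τ ∧ IsNSFreeEvolution ν (w T₀) T₁ x),
    nsAction T₀ g

variable {ν τ τ' : ℝ} {x : E → E}

/-- Every admissible path followed by a free tail reaching `x` within total time `τ` bounds the
two-piece quasipotential by the action of its forced piece (`iInf_le`). [folklore] -/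
theorem nsQuasipotentialWithTail_le {T₀ T₁ : ℝ} {w : ℝ → E → E} {q : ℝ → E → ℝ} {g : ℝ → E → E}
    (h : IsNSControlPathOn ν T₀ w q g) (hT₁ : 0 ≤ T₁) (hT : T₀ + T₁ ≤ τ)
    (hx : IsNSFreeEvolution ν (w T₀) T₁ x) : nsQuasipotentialWithTail ν τ x ≤ nsAction T₀ g :=
  iInf_le_of_le T₀ <| iInf_le_of_le T₁ <| iInf_le_of_le w <| iInf_le_of_le q <| iInf_le_of_le g <|
    iInf_le _ ⟨h, hT₁, hT, hx⟩

/-- Lower bounds for the two-piece quasipotential (`le_iInf_iff`). [folklore] -/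
theorem le_nsQuasipotentialWithTail_iff {a : ℝ≥0∞} :
    a ≤ nsQuasipotentialWithTail ν τ x ↔
      ∀ (T₀ T₁ : ℝ) (w : ℝ → E → E) (q : ℝ → E → ℝ) (g : ℝ → E → E),
        IsNSControlPathOn ν T₀ w q g → 0 ≤ T₁ → T₀ + T₁ ≤ τ → IsNSFreeEvolution ν (w T₀) T₁ x →
          a ≤ nsAction T₀ g := by
  simp only [nsQuasipotentialWithTail, le_iInf_iff, and_imp]

/-- Strict upper bounds for the two-piece quasipotential (`iInf_lt_iff`). [folklore] -/
theorem nsQuasipotentialWithTail_lt_iff {a : ℝ≥0∞} :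
    nsQuasipotentialWithTail ν τ x < a ↔
      ∃ (T₀ T₁ : ℝ) (w : ℝ → E → E) (q : ℝ → E → ℝ) (g : ℝ → E → E),
        IsNSControlPathOn ν T₀ w q g ∧ 0 ≤ T₁ ∧ T₀ + T₁ ≤ τ ∧ IsNSFreeEvolution ν (w T₀) T₁ x ∧
          nsAction T₀ g < a := by
  simp only [nsQuasipotentialWithTail, iInf_lt_iff, exists_prop, and_assoc]

/-- The two-piece quasipotential is antitone in the horizon. [folklore] -/
theorem nsQuasipotentialWithTail_anti (h : τ ≤ τ') :
    nsQuasipotentialWithTail ν τ' x ≤ nsQuasipotentialWithTail ν τ x :=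
  le_nsQuasipotentialWithTail_iff.2 fun _ _ _ _ _ hp hT₁ hT hx =>
    nsQuasipotentialWithTail_le hp hT₁ (hT.trans h) hx

/-- With a non-positive horizon nothing is reachable: `Ṽ_{ν,τ} ≡ ⊤` for `τ ≤ 0`. [folklore] -/
theorem nsQuasipotentialWithTail_eq_top_of_nonpos (hτ : τ ≤ 0) :
    nsQuasipotentialWithTail ν τ x = ⊤ :=
  eq_top_iff.2 <| le_nsQuasipotentialWithTail_iff.2 fun _ _ _ _ _ hp hT₁ hT _ => by
    have := hp.pos
    exact absurd (show (0 : ℝ) < 0 by linarith) (lt_irrefl 0)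

/-- **The Lyapunov inequality along the free flow (definitional).** If `(u, p)` is an unforced
classical solution on `[0, T)` which is Leray–Hopf from `u 0`, then every slice `u t`, `t < T`, is
reachable within horizon `τ + t` at no more than the cost of reaching `u 0` within `τ`:
`Ṽ_{ν,τ+t}(u t) ≤ V_{ν,τ}(u 0)` — follow any controlled path to `u 0`, then `u` itself for free
(the concatenation argument of Freidlin 1985, §4.1 / Freidlin–Wentzell, Ch. 4, for the
monotonicity of the quasi-potential along unperturbed trajectories). [folklore] -/
theorem nsQuasipotentialWithTail_le_nsQuasipotential_of_flow {T : ℝ} {u : ℝ → E → E}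
    {p : ℝ → E → ℝ} (hu : IsClassicalNSSolutionOn (Ico 0 T) ν 0 u p)
    (hLH : IsLerayHopfOn T ν 0 (u 0) u) {t : ℝ} (ht : t ∈ Ico 0 T) (τ : ℝ) :
    nsQuasipotentialWithTail ν (τ + t) (u t) ≤ nsQuasipotential ν τ (u 0) :=
  le_nsQuasipotential_iff.2 fun _ _ _ _ hp hT hx =>
    nsQuasipotentialWithTail_le hp ht.1 (by linarith)
      ⟨T, u, p, ht.2, hu, hx ▸ hLH, hx.symm ▸ rfl, rfl⟩

/-- **Bridge to the literal reachable-set predicate.** If `x` is reachable within total time `τ`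
by a controlled path from rest of action `≤ a` followed by a free classical Leray–Hopf tail — the
predicate inlined, conjunct by conjunct, in the coercivity statements of route
QuasipotentialCoercivity — then `Ṽ_{ν,τ}(x) ≤ a`. [folklore] -/
theorem nsQuasipotentialWithTail_le_of_reach {a : ℝ≥0∞}
    (h : ∃ (T₀ T₁ : ℝ) (w : ℝ → E → E) (q : ℝ → E → ℝ) (g : ℝ → E → E),
      (0 < T₀ ∧ IsClassicalNSSolutionOn (Icc 0 T₀) ν g w q ∧ HasUniformRapidDecayOn (Icc 0 T₀) w ∧
        w 0 = 0 ∧ (∫⁻ s in Icc 0 T₀, eEnergy (g s)) ≤ a) ∧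
      (0 ≤ T₁ ∧ T₀ + T₁ ≤ τ ∧ ∃ (T₂ : ℝ) (v : ℝ → E → E) (pv : ℝ → E → ℝ), T₁ < T₂ ∧
        IsClassicalNSSolutionOn (Ico 0 T₂) ν 0 v pv ∧ IsLerayHopfOn T₂ ν 0 (w T₀) v ∧
        v 0 = w T₀ ∧ v T₁ = x)) :
    nsQuasipotentialWithTail ν τ x ≤ a := by
  obtain ⟨T₀, T₁, w, q, g, ⟨h0, hcl, hdec, hw0, ha⟩, hT₁, hT, htail⟩ := h
  exact (nsQuasipotentialWithTail_le ⟨h0, hcl, hdec, hw0⟩ hT₁ hT htail).trans ha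

/-- **Converse bridge.** If `Ṽ_{ν,τ}(x) < a` then `x` is reachable, in the literal sense of the
route statements, with action `≤ a` (indeed `< a`; `iInf_lt_iff`). [folklore] -/
theorem reach_of_nsQuasipotentialWithTail_lt {a : ℝ≥0∞} (h : nsQuasipotentialWithTail ν τ x < a) :
    ∃ (T₀ T₁ : ℝ) (w : ℝ → E → E) (q : ℝ → E → ℝ) (g : ℝ → E → E),
      (0 < T₀ ∧ IsClassicalNSSolutionOn (Icc 0 T₀) ν g w q ∧ HasUniformRapidDecayOn (Icc 0 T₀) w ∧
        w 0 = 0 ∧ (∫⁻ s in Icc 0 T₀, eEnergy (g s)) ≤ a) ∧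
      (0 ≤ T₁ ∧ T₀ + T₁ ≤ τ ∧ ∃ (T₂ : ℝ) (v : ℝ → E → E) (pv : ℝ → E → ℝ), T₁ < T₂ ∧
        IsClassicalNSSolutionOn (Ico 0 T₂) ν 0 v pv ∧ IsLerayHopfOn T₂ ν 0 (w T₀) v ∧
        v 0 = w T₀ ∧ v T₁ = x) := by
  obtain ⟨T₀, T₁, w, q, g, hp, hT₁, hT, htail, ha⟩ := nsQuasipotentialWithTail_lt_iff.1 h
  exact ⟨T₀, T₁, w, q, g, ⟨hp.pos, hp.isClassical, hp.decay, hp.initial, ha.le⟩, hT₁, hT, htail⟩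

/-- **Coercivity over the reachable set = coercivity on sublevel sets.** For any `[0, ∞]`-valued
size functional `Q` (e.g. `Q x = ‖x‖_{L³}` or `∫⁻ |∇x|²`), "for every action level `a` there is
`C` with `Q x ≤ C` on `{Ṽ_{ν,τ} ≤ a}`" is equivalent to the same statement over the literal
reachable set at level `a` (the shape of the route's items): `→` by
`nsQuasipotentialWithTail_le_of_reach`; `←` using the constant for level `a + 1`, since
`Ṽ ≤ a < a + 1` gives literal reachability at level `a + 1`
(`reach_of_nsQuasipotentialWithTail_lt`). [folklore] -/
theorem nsQuasipotentialWithTail_sublevel_iff_reach (Q : (E → E) → ℝ≥0∞) :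
    (∀ a : ℝ≥0, ∃ C : ℝ≥0, ∀ x : E → E, nsQuasipotentialWithTail ν τ x ≤ (a : ℝ≥0∞) →
        Q x ≤ (C : ℝ≥0∞)) ↔
    (∀ a : ℝ≥0, ∃ C : ℝ≥0, ∀ x : E → E,
      (∃ (T₀ T₁ : ℝ) (w : ℝ → E → E) (q : ℝ → E → ℝ) (g : ℝ → E → E),
        (0 < T₀ ∧ IsClassicalNSSolutionOn (Icc 0 T₀) ν g w q ∧ HasUniformRapidDecayOn (Icc 0 T₀) w ∧
          w 0 = 0 ∧ (∫⁻ s in Icc 0 T₀, eEnergy (g s)) ≤ (a : ℝ≥0∞)) ∧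
        (0 ≤ T₁ ∧ T₀ + T₁ ≤ τ ∧ ∃ (T₂ : ℝ) (v : ℝ → E → E) (pv : ℝ → E → ℝ), T₁ < T₂ ∧
          IsClassicalNSSolutionOn (Ico 0 T₂) ν 0 v pv ∧ IsLerayHopfOn T₂ ν 0 (w T₀) v ∧
          v 0 = w T₀ ∧ v T₁ = x)) → Q x ≤ (C : ℝ≥0∞)) := by
  constructor
  · intro h a
    obtain ⟨C, hC⟩ := h a
    exact ⟨C, fun x hx => hC x (nsQuasipotentialWithTail_le_of_reach hx)⟩
  · intro h a
    obtain ⟨C, hC⟩ := h (a + 1)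
    refine ⟨C, fun x hx => hC x (reach_of_nsQuasipotentialWithTail_lt ?_)⟩
    calc nsQuasipotentialWithTail ν τ x ≤ (a : ℝ≥0∞) := hx
      _ < ((a + 1 : ℝ≥0) : ℝ≥0∞) := by exact_mod_cast lt_add_one a

/-! #### The rest state: the zero Leray–Hopf tail -/

/-- The zero field has the zero field as weak gradient (integration by parts against test
functions is `0 = 0`). [folklore] -/
theorem hasWeakGradient_zero : HasWeakGradient (0 : E → E) (fun _ => (0 : E →L[ℝ] E)) where
  locallyIntegrableOn := locallyIntegrableOn_const (0 : E)
  locallyIntegrableOn_deriv := locallyIntegrableOn_const (0 : E →L[ℝ] E)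
  integral_fderiv_smul_eq φ v _ := by simp

/-- **The rest state is a Leray–Hopf solution**: `u ≡ 0` is a Leray–Hopf weak solution of the
unforced system on every `[0, T)` with datum `0` (all clauses are identities `0 = 0` or bounds
`0 ≤ 0`). [folklore] -/
theorem isLerayHopfOn_zero (T ν : ℝ) : IsLerayHopfOn T ν 0 (0 : E → E) (0 : ℝ → E → E) where
  weak := by
    have hc : Continuous (uncurry (0 : ℝ → E → E)) := continuous_const
    have h0 : uncurry (0 : ℝ → E → E) = fun _ => 0 := rfl
    refine ⟨hc.aestronglyMeasurable, fun K _ => by rw [h0]; simp, ae_of_all _ fun t => ?_,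
      fun ψ _ _ => by simp⟩
    intro θ _
    simp
  energy_bound := ⟨0, ae_of_all _ fun t => by simp [eEnergy]⟩
  memLp := fun t _ => by simp
  weakGrad_energy := by
    refine ⟨fun _ _ => 0, ae_of_all _ fun t => ?_, by simp, fun t _ => ?_,
      ae_of_all _ fun s t _ => ?_⟩
    · simpa using (hasWeakGradient_zero (E := E))
    · simp [VectorCalculus.kineticEnergy]
    · simp [VectorCalculus.kineticEnergy]
  weak_continuous := fun w _ => ⟨by simpa using continuousOn_const, by simp⟩
  strong_initial := by simp

/-- The rest state evolves freely to itself in any time `T₁` (the zero solution on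
`[0, T₁ + 1)`). [folklore] -/
theorem isNSFreeEvolution_zero (ν T₁ : ℝ) : IsNSFreeEvolution ν (0 : E → E) T₁ 0 :=
  ⟨T₁ + 1, 0, 0, lt_add_one T₁, isClassicalNSSolutionOn_zero _ ν, isLerayHopfOn_zero _ ν, rfl, rfl⟩

/-- **The rest state has zero two-piece quasipotential**: `Ṽ_{ν,τ}(0) = 0` for `τ > 0` (resting
forced piece on `[0, τ]`, trivial free tail of length `0`). [cite: Freidlin1985, §4.1] -/
theorem nsQuasipotentialWithTail_zero (ν : ℝ) (hτ : 0 < τ) :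
    nsQuasipotentialWithTail ν τ (0 : E → E) = 0 := by
  refine le_antisymm ?_ bot_le
  have htail : IsNSFreeEvolution ν ((0 : ℝ → E → E) τ) 0 0 := isNSFreeEvolution_zero (E := E) ν 0
  have h := nsQuasipotentialWithTail_le (τ := τ) (x := (0 : E → E))
    (isNSControlPathOn_zero (E := E) ν hτ) le_rfl (add_zero τ).le htail
  simpa using h

end Tail

/-! ### Covariance-weighted version -/

section Cov

variable {E : Type*} [NormedAddCommGroup E] [InnerProductSpace ℝ E] [FiniteDimensional ℝ E]
  [MeasurableSpace E] [BorelSpace E]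

/-- **The covariance-weighted finite-horizon quasipotential** `V^R_{ν,τ}(x) = inf A_{T₀}(h)` over
controls `h` whose image `g s = R (h s)` under a fixed operator `R` on spatial fields drives an
admissible classical path from rest to `x` within time `τ`. For noise `√Q Ẇ` with covariance `Q`
(Da Prato–Zabczyk convention) take `R = Q^{1/2}`; in Brzeźniak–Cerrai–Freidlin (2015), §1 and
(5.x), the noise is `w^{Q_δ} = Σ Q_δ e_k β_k` and the action is
`S^δ_T(u) = ½ ∫ |Q_δ⁻¹(u' + νAu + B(u,u))|²_H dt`, i.e. `R = Q_δ` (again we drop the `½`, and we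
charge the control `h` directly instead of inverting `R`, so no injectivity of `R` is needed;
for non-injective `R` this is the usual `inf` over preimages). `R = id` is `nsQuasipotential`
(`nsQuasipotentialCov_id`). [cite: BrzezniakCerraiFreidlin2015, §1 (S^δ_T and U_δ)] -/
def nsQuasipotentialCov (R : (E → E) → (E → E)) (ν τ : ℝ) (x : E → E) : ℝ≥0∞ :=
  ⨅ (T₀ : ℝ) (w : ℝ → E → E) (q : ℝ → E → ℝ) (h : ℝ → E → E)
    (_ : IsNSControlPathOn ν T₀ w q (fun s => R (h s)) ∧ T₀ ≤ τ ∧ w T₀ = x), nsAction T₀ h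

variable {R : (E → E) → (E → E)} {ν τ : ℝ} {x : E → E}

/-- Every admissible `R`-controlled path reaching `x` within `τ` bounds `V^R_{ν,τ}(x)` by the
action of its control (`iInf_le`). [cite: BrzezniakCerraiFreidlin2015, §1 (S^δ_T and U_δ)] -/
theorem nsQuasipotentialCov_le {T₀ : ℝ} {w : ℝ → E → E} {q : ℝ → E → ℝ} {h : ℝ → E → E}
    (hp : IsNSControlPathOn ν T₀ w q (fun s => R (h s))) (hT : T₀ ≤ τ) (hx : w T₀ = x) :
    nsQuasipotentialCov R ν τ x ≤ nsAction T₀ h :=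
  iInf_le_of_le T₀ <| iInf_le_of_le w <| iInf_le_of_le q <| iInf_le_of_le h <| iInf_le _ ⟨hp, hT, hx⟩

/-- Lower bounds for the covariance-weighted quasipotential (`le_iInf_iff`). [cite: BrzezniakCerraiFreidlin2015, §1 (S^δ_T and U_δ)] -/
theorem le_nsQuasipotentialCov_iff {a : ℝ≥0∞} :
    a ≤ nsQuasipotentialCov R ν τ x ↔ ∀ (T₀ : ℝ) (w : ℝ → E → E) (q : ℝ → E → ℝ) (h : ℝ → E → E),
      IsNSControlPathOn ν T₀ w q (fun s => R (h s)) → T₀ ≤ τ → w T₀ = x → a ≤ nsAction T₀ h := by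
  simp only [nsQuasipotentialCov, le_iInf_iff, and_imp]

/-- **Identity covariance**: `V^{id}_{ν,τ} = V_{ν,τ}` (definitionally). [cite: BrzezniakCerraiFreidlin2015, §6 (U = U_0)] -/
theorem nsQuasipotentialCov_id (ν τ : ℝ) (x : E → E) :
    nsQuasipotentialCov id ν τ x = nsQuasipotential ν τ x :=
  rfl

end Cov

end Literature.Analysis.FluidPDE
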